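import Mathlib.Data.Finset.Image
import Mathlib.Data.Finset.Card
import Mathlib.Logic.Equiv.Fin.Basic
import Mathlib.Logic.Equiv.Set
import Mathlib.Data.Fintype.Basic
import HarnessLib

/-!
# Matching minors (weak containment) of bipartite graphs with a perfect matching

Topic `Combinatorics/SimpleGraph`; definitions + small API, no named facts. Requested by the
definition item `defn-IsMatchingMinor` of route `ValiantsHypothesis/PolyaContinued`
(item `MonotoneCoverHard`), in that route's encoding: a bipartite graph `G ⊆ K_{n,n}` with colour
classes "rows" `Fin n` and "columns" `Fin n` is its EDGE SET `G : Finset (Fin n × Fin n)` (the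
support of the symbolic biadjacency matrix whose permanent is the perfect-matching polynomial
`PM_G = per(X|_G)` of the route); its vertex set is all of `Fin n ⊔ Fin n` (isolated vertices
allowed).

The notion, as printed (Robertson–Seymour–Thomas 1999, §4, before (4.2); the same notion is called
a **matching minor** by Norine–Thomas and in Lucchesi–Murty, *Perfect Matchings* (2024), and
"central" = "conformal" = McCuaig's "well-fitted"):

> Let `G` be a graph, let `u` be a vertex of `G` of degree two, let `e` and `f` be the two edges of
> `G` incident with `u`, and let `G′` be obtained from `G` by contracting both `e` and `f` and
> deleting parallel edges. We say that `G′` was obtained from `G` by a *bicontraction*. We say that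
> a graph `H` is *weakly contained* in a graph `G` … if `G` has a subgraph `K` such that
> `G ∖ V(K)` has a perfect matching and a graph isomorphic to `H` can be obtained from `K` by a
> sequence of bicontractions.

(§1: a subgraph `H` of `G` is *central* if `G ∖ V(H)` has a perfect matching.)

## Contents

* `HasPerfectMatching G` — `G ⊆ K_{n,n}` has a perfect matching (a permutation `σ` with all
  `(i, σ i) ∈ G`);
* `Adj G`, `IsIsomorphic G G'` — the adjacency relation of the encoded graph on the vertex set
  `Fin n ⊕ Fin n` and ISOMORPHISM OF THE UNDERLYING ABSTRACT GRAPHS (any adjacency-preserving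
  bijection of `Fin n ⊕ Fin n`; it may exchange the colour classes on some components only);
  `relabel G ρ κ`, `transposeEdges G` are particular isomorphisms (`isIsomorphic_relabel`,
  `isIsomorphic_transposeEdges`);
* `IsCentralSubgraph K G` — `K ⊆ K_{k,k}` is (isomorphic to) a **central (= conformal) subgraph**
  of `G ⊆ K_{n,n}`: rows/columns of `K` embed into those of `G`, edges into edges, and the
  complementary rows and columns of `G` carry a perfect matching of `G ∖ V(K)` (so `K` is
  automatically balanced, as it must be);
* `bicontractRowZero G` — the **bicontraction** of the row vertex `0` of `G ⊆ K_{m+2,m+2}` in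
  normal position (neighbours: the columns `0` and `1`): delete row `0`, merge columns `0, 1`,
  shift indices down (parallel edges disappear in the `Finset`); `RowZeroBicontractible G` — row
  `0` has degree two with neighbourhood `{0, 1}`; `BicontractionStep G G'` — `G'` is, up to
  isomorphism on both sides, `bicontractRowZero` of `G` (bicontracting a COLUMN vertex, or any row
  vertex with any two neighbours, is the normal-position step after an isomorphism, transposition
  included);
* `Bicontracts G H` (inductive) — a graph isomorphic to `H` is obtained from `G` by a (possibly
  empty) **sequence of bicontractions**;
* `IsMatchingMinor H G` — **`H` is weakly contained in / a matching minor of `G`**: some central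
  subgraph `K` of `G` `Bicontracts` to `H`.
* API (proved): `IsIsomorphic.refl`, `isIsomorphic_relabel`, `isIsomorphic_transposeEdges`,
  `isCentralSubgraph_self`, `Bicontracts.refl`,
  `IsMatchingMinor.refl`, `IsMatchingMinor.of_isCentralSubgraph`, and the worked example
  `bicontractRowZero_hexagon` (`C₆ ↦ C₄ = K_{2,2}`, so `K_{2,2}` is a matching minor of the
  hexagon: `isMatchingMinor_K22_hexagon`).

## Design notes / what is NOT here

* Faithfulness: vertices of `K` = all `k` rows and `k` columns of its index types; a subgraph of
  `G` with vertex set `V(K)` and edge set inside `G[V(K)]` is exactly an `IsCentralSubgraph`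
  datum up to the relabelling `Fin k ≃ V(K) ∩ rows`, `Fin k ≃ V(K) ∩ cols` (balancedness of `K` is
  forced by the perfect matching of `G ∖ V(K)` since `G`'s classes have equal size `n`).
  Bicontraction at a vertex `u` of degree two: after an isomorphism `u` is the row `0` with
  neighbours the columns `0, 1` (`RowZeroBicontractible`), so the normal-position operation
  generates all bicontractions; "a graph isomorphic to `H`" is the `IsIsomorphic` closure built
  into `BicontractionStep`/`Bicontracts`, with `IsIsomorphic` = isomorphism of abstract graphs
  (review of the first version: with bigraph isomorphism — rows to rows up to ONE global
  transposition — the notion would be strictly narrower than the printed one for disconnected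
  `H`, e.g. `H = A ⊔ A` vs `G = A ⊔ Aᵀ`; for connected `H`, such as `K_{3,3}`, the two agree).
  The intermediate graphs of a bicontraction sequence are re-encoded with their own balanced
  bipartitions; bicontraction is an operation on abstract graphs, so this is harmless.
* Route follow-ups (item `defn-IsMatchingMinor`, (i)–(iii)), NOT in this file: each operation
  makes `PM_H` a Valiant projection of `PM_G` (so `dc(PM_H) ≤ dc(PM_G)` by
  `determinantalComplexity_le_of_isProjection`); Little's theorem (K₃,₃ as the excluded matching
  minor of Pfaffian bipartite graphs; RST 1999 (1.2) with (4.2): for `H` of maximum degree three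
  "contained" = "weakly contained"); tight cuts and braces.
* Mathlib has `SimpleGraph` minors only in rudimentary form and nothing on matchings minors,
  conformal subgraphs or bicontraction (`lean search 'bicontract|matchingMinor|conformal sub'`:
  no hits); the edge-set encoding is the route's, not Mathlib's `SimpleGraph`.

## References

* N. Robertson, P. D. Seymour, R. Thomas, *Permanents, Pfaffian orientations, and even directed
  circuits*, Ann. of Math. 150 (1999) 929–975 (arXiv:math/9911268): §1 (central subgraphs,
  "contains"), §4 before (4.2) (bicontraction, weak containment), (4.2). [RobertsonSeymourThomas1999]
* W. McCuaig, *Pólya's permanent problem*, Electron. J. Combin. 11 (2004) R79, §1 (well-fitted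
  subgraphs, bisubdivisions).
* C. L. Lucchesi, U. S. R. Murty, *Perfect Matchings*, Springer (2024) (matching minors).
-/

namespace Literature.Combinatorics.SimpleGraph

/-! ### Bipartite graphs as edge sets; perfect matchings; isomorphisms -/

/-- `G ⊆ K_{n,n}` (edge set on rows `Fin n` × columns `Fin n`) **has a perfect matching**: there is
a bijection `σ` rows → columns all of whose pairs are edges. [folklore] -/
def HasPerfectMatching {n : ℕ} (G : Finset (Fin n × Fin n)) : Prop :=
  ∃ σ : Equiv.Perm (Fin n), ∀ i, (i, σ i) ∈ G

/-- Relabelling rows by `ρ` and columns by `κ`. [folklore] -/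
def relabel {n : ℕ} (G : Finset (Fin n × Fin n)) (ρ κ : Equiv.Perm (Fin n)) :
    Finset (Fin n × Fin n) :=
  G.map (ρ.prodCongr κ).toEmbedding

/-- Exchanging the two colour classes (transposing the biadjacency support). [folklore] -/
def transposeEdges {n : ℕ} (G : Finset (Fin n × Fin n)) : Finset (Fin n × Fin n) :=
  G.map (Equiv.prodComm (Fin n) (Fin n)).toEmbedding

/-- The **adjacency relation** of the bipartite graph encoded by `G` on the vertex set
`Fin n ⊕ Fin n` (rows `inl i`, columns `inr j`; `inl i ~ inr j ↔ (i, j) ∈ G`, symmetric, no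
edges inside a class). [folklore] -/
def Adj {n : ℕ} (G : Finset (Fin n × Fin n)) : Fin n ⊕ Fin n → Fin n ⊕ Fin n → Prop
  | Sum.inl i, Sum.inr j => (i, j) ∈ G
  | Sum.inr j, Sum.inl i => (i, j) ∈ G
  | Sum.inl _, Sum.inl _ => False
  | Sum.inr _, Sum.inr _ => False

/-- **Isomorphism of the underlying (abstract) graphs**: a bijection of the vertex sets
`Fin n ⊕ Fin n` preserving adjacency. This is graph isomorphism, NOT merely bigraph isomorphism:
it need not map rows to rows — e.g. it may exchange the colour classes on one connected component
only (for `A ⊆ K_{3,3}` the block sums `A ⊔ A` and `A ⊔ Aᵀ` are isomorphic graphs but not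
isomorphic bigraphs), which "a graph isomorphic to `H`" in Robertson–Seymour–Thomas's definition
allows. Independent relabellings of rows and columns (`isIsomorphic_relabel`) and the global
transposition (`isIsomorphic_transposeEdges`) are particular isomorphisms. [folklore] -/
def IsIsomorphic {n : ℕ} (G G' : Finset (Fin n × Fin n)) : Prop :=
  ∃ φ : Fin n ⊕ Fin n ≃ Fin n ⊕ Fin n, ∀ a b, Adj G a b ↔ Adj G' (φ a) (φ b)

/-- Membership in a relabelling. [folklore] -/
theorem mem_relabel_iff {n : ℕ} (G : Finset (Fin n × Fin n)) (ρ κ : Equiv.Perm (Fin n))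
    (e : Fin n × Fin n) : e ∈ relabel G ρ κ ↔ (ρ.symm e.1, κ.symm e.2) ∈ G := by
  simp only [relabel, Finset.mem_map_equiv]
  rfl

/-- Relabelling by the identity permutations does nothing. [folklore] -/
@[simp] theorem relabel_refl {n : ℕ} (G : Finset (Fin n × Fin n)) :
    relabel G (Equiv.refl _) (Equiv.refl _) = G := by
  ext e
  rw [mem_relabel_iff]
  simp

/-- Every graph is isomorphic to itself. [folklore] -/
theorem IsIsomorphic.refl {n : ℕ} (G : Finset (Fin n × Fin n)) : IsIsomorphic G G :=
  ⟨Equiv.refl _, fun _ _ => Iff.rfl⟩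

/-- Relabelling rows by `ρ` and columns by `κ` is an isomorphism (`φ = ρ ⊕ κ`). [folklore] -/
theorem isIsomorphic_relabel {n : ℕ} (G : Finset (Fin n × Fin n)) (ρ κ : Equiv.Perm (Fin n)) :
    IsIsomorphic G (relabel G ρ κ) := by
  refine ⟨Equiv.sumCongr ρ κ, fun a b => ?_⟩
  rcases a with i | j <;> rcases b with i' | j' <;>
    simp [Adj, mem_relabel_iff]

/-- Exchanging the colour classes is an isomorphism (`φ = Sum.swap`). [folklore] -/
theorem isIsomorphic_transposeEdges {n : ℕ} (G : Finset (Fin n × Fin n)) :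
    IsIsomorphic G (transposeEdges G) := by
  refine ⟨Equiv.sumComm (Fin n) (Fin n), fun a b => ?_⟩
  have hmem : ∀ i j : Fin n, (j, i) ∈ transposeEdges G ↔ (i, j) ∈ G := fun i j => by
    simp only [transposeEdges, Finset.mem_map_equiv]
    rfl
  rcases a with i | j <;> rcases b with i' | j' <;> simp [Adj, hmem]

/-! ### Central (conformal) subgraphs -/

/-- **`K` is a central (= conformal, = well-fitted) subgraph of `G`** (Robertson–Seymour–Thomas
1999, §1: "`H` is central if `G ∖ V(H)` has a perfect matching"), in the edge-set encoding:
`K ⊆ K_{k,k}` with its `k` rows and `k` columns embedded into those of `G ⊆ K_{n,n}` by `r`, `c`,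
every edge of `K` an edge of `G`, and a perfect matching `τ` of `G` on the complementary rows and
columns. [cite: RobertsonSeymourThomas1999, §1 (central subgraphs)] -/
def IsCentralSubgraph {k n : ℕ} (K : Finset (Fin k × Fin k)) (G : Finset (Fin n × Fin n)) : Prop :=
  ∃ (r c : Fin k ↪ Fin n), (∀ e ∈ K, (r e.1, c e.2) ∈ G) ∧
    ∃ τ : {i : Fin n // i ∉ Set.range r} ≃ {j : Fin n // j ∉ Set.range c},
      ∀ i : {i : Fin n // i ∉ Set.range r},
        ((i : Fin n), ((τ i : {j : Fin n // j ∉ Set.range c}) : Fin n)) ∈ G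

/-- `G` is a central subgraph of itself (the complement is empty). [folklore] -/
theorem isCentralSubgraph_self {n : ℕ} (G : Finset (Fin n × Fin n)) : IsCentralSubgraph G G := by
  refine ⟨Function.Embedding.refl _, Function.Embedding.refl _, fun e he => he, ?_⟩
  haveI hE : IsEmpty {i : Fin n // i ∉ Set.range (Function.Embedding.refl (Fin n))} :=
    ⟨fun i => i.2 ⟨i.1, rfl⟩⟩
  exact ⟨Equiv.equivOfIsEmpty _ _, fun i => (hE.false i).elim⟩

/-! ### Bicontraction -/

/-- Shifting an index of `Fin (m + 2)` down by one, truncating at `0` (so `0, 1 ↦ 0` and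
`j + 1 ↦ j`): the quotient map merging the columns `0` and `1`, and (restricted to non-zero
rows) the renumbering of the surviving rows. [folklore] -/
def shiftDown {m : ℕ} (j : Fin (m + 2)) : Fin (m + 1) :=
  ⟨j.val - 1, by omega⟩

/-- **Bicontraction in normal position**: bicontract the row vertex `0` of `G ⊆ K_{m+2,m+2}` whose
two neighbours are the columns `0` and `1` — delete row `0` with its two edges, identify the
columns `0` and `1`, renumber (Robertson–Seymour–Thomas 1999, §4: "contracting both `e` and `f`
and deleting parallel edges"; parallel edges merge in the `Finset`). Meaningful under
`RowZeroBicontractible G`. [cite: RobertsonSeymourThomas1999, §4 (bicontraction, before (4.2))] -/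
def bicontractRowZero {m : ℕ} (G : Finset (Fin (m + 2) × Fin (m + 2))) :
    Finset (Fin (m + 1) × Fin (m + 1)) :=
  (G.filter fun e => e.1 ≠ 0).image fun e => (shiftDown e.1, shiftDown e.2)

/-- Row `0` is a vertex of degree two with neighbours the columns `0` and `1`. [folklore] -/
def RowZeroBicontractible {m : ℕ} (G : Finset (Fin (m + 2) × Fin (m + 2))) : Prop :=
  G.filter (fun e => e.1 = 0) = {((0 : Fin (m + 2)), (0 : Fin (m + 2))), (0, 1)}

/-- **One bicontraction, up to isomorphism**: `G'` is isomorphic to the normal-position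
bicontraction of a graph isomorphic to `G` in which row `0` has degree two with neighbours the
columns `0, 1`. Every bicontraction of a vertex of degree two (row or column, any neighbours) is
of this form. [cite: RobertsonSeymourThomas1999, §4 (bicontraction, before (4.2))] -/
def BicontractionStep {m : ℕ} (G : Finset (Fin (m + 2) × Fin (m + 2)))
    (G' : Finset (Fin (m + 1) × Fin (m + 1))) : Prop :=
  ∃ G₀ : Finset (Fin (m + 2) × Fin (m + 2)), IsIsomorphic G G₀ ∧ RowZeroBicontractible G₀ ∧
    IsIsomorphic (bicontractRowZero G₀) G'

/-- **A graph isomorphic to `H` is obtained from `G` by a sequence of bicontractions**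
(Robertson–Seymour–Thomas 1999, §4), as an inductive relation between edge sets of possibly
different sizes: no step (an isomorphism), or one `BicontractionStep` followed by a sequence.
[cite: RobertsonSeymourThomas1999, §4 (weak containment, before (4.2))] -/
inductive Bicontracts : {n m : ℕ} → Finset (Fin n × Fin n) → Finset (Fin m × Fin m) → Prop
  | of_isIsomorphic {n : ℕ} {G H : Finset (Fin n × Fin n)} : IsIsomorphic G H → Bicontracts G H
  | step {n m : ℕ} {G : Finset (Fin (n + 2) × Fin (n + 2))} {G' : Finset (Fin (n + 1) × Fin (n + 1))}
      {H : Finset (Fin m × Fin m)} :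
      BicontractionStep G G' → Bicontracts G' H → Bicontracts G H

/-- **`H` is a matching minor of `G`** (= `H` is *weakly contained* in `G`, Robertson–Seymour–Thomas
1999, §4: "`G` has a subgraph `K` such that `G ∖ V(K)` has a perfect matching and a graph
isomorphic to `H` can be obtained from `K` by a sequence of bicontractions"; Norine–Thomas /
Lucchesi–Murty: matching minor), for bipartite graphs in the edge-set encoding of route
`PolyaContinued`. [cite: RobertsonSeymourThomas1999, §4 (weak containment, before (4.2))] -/
def IsMatchingMinor {m n : ℕ} (H : Finset (Fin m × Fin m)) (G : Finset (Fin n × Fin n)) : Prop :=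
  ∃ (k : ℕ) (K : Finset (Fin k × Fin k)), IsCentralSubgraph K G ∧ Bicontracts K H

/-! ### API -/

/-- An isomorphic graph is obtained by the empty sequence of bicontractions. [folklore] -/
theorem Bicontracts.refl {n : ℕ} (G : Finset (Fin n × Fin n)) : Bicontracts G G :=
  Bicontracts.of_isIsomorphic (IsIsomorphic.refl G)

/-- A central subgraph is a matching minor. [folklore] -/
theorem IsMatchingMinor.of_isCentralSubgraph {k n : ℕ} {K : Finset (Fin k × Fin k)}
    {G : Finset (Fin n × Fin n)} (h : IsCentralSubgraph K G) : IsMatchingMinor K G :=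
  ⟨k, K, h, Bicontracts.refl K⟩

/-- Every graph is a matching minor of itself. [folklore] -/
theorem IsMatchingMinor.refl {n : ℕ} (G : Finset (Fin n × Fin n)) : IsMatchingMinor G G :=
  IsMatchingMinor.of_isCentralSubgraph (isCentralSubgraph_self G)

/-- A graph reached from `G` by bicontractions is a matching minor of `G`. [folklore] -/
theorem IsMatchingMinor.of_bicontracts {m n : ℕ} {G : Finset (Fin n × Fin n)}
    {H : Finset (Fin m × Fin m)} (h : Bicontracts G H) : IsMatchingMinor H G :=
  ⟨n, G, isCentralSubgraph_self G, h⟩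

/-! ### Worked example: the hexagon bicontracts to `K_{2,2}` -/

/-- The hexagon `C₆ ⊆ K_{3,3}`: rows `i` adjacent to columns `i` and `i + 1 (mod 3)`. [folklore] -/
def hexagon : Finset (Fin 3 × Fin 3) := {(0, 0), (0, 1), (1, 1), (1, 2), (2, 2), (2, 0)}

/-- `K_{2,2} = C₄`. [folklore] -/
def completeBipartiteTwo : Finset (Fin 2 × Fin 2) := {(0, 0), (0, 1), (1, 0), (1, 1)}

/-- In the hexagon, row `0` has degree two with neighbours the columns `0, 1`. [folklore] -/
theorem rowZeroBicontractible_hexagon : RowZeroBicontractible hexagon := by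
  unfold RowZeroBicontractible hexagon
  decide

/-- **Bicontracting a vertex of the hexagon gives the `4`-cycle `K_{2,2}`.** [folklore] -/
theorem bicontractRowZero_hexagon : bicontractRowZero hexagon = completeBipartiteTwo := by
  unfold bicontractRowZero hexagon completeBipartiteTwo
  decide

/-- `K_{2,2}` is a matching minor of the hexagon (one bicontraction; the hexagon is a central
subgraph of itself). [folklore] -/
theorem isMatchingMinor_K22_hexagon : IsMatchingMinor completeBipartiteTwo hexagon :=
  IsMatchingMinor.of_bicontracts
    (Bicontracts.step ⟨hexagon, IsIsomorphic.refl _, rowZeroBicontractible_hexagon,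
      bicontractRowZero_hexagon ▸ IsIsomorphic.refl _⟩ (Bicontracts.refl _))

end Literature.Combinatorics.SimpleGraph
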